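import Summits.BirchSwinnertonDyer.BirchSwinnertonDyer.Theorems.CyclotomicUntwistEigensymbolPushforward
import HarnessLib

/-!
# Untwist eigensymbols, IV: the CANONICAL (`g`-free) eigensymbol on `ℤ[1/p]` — additivity and every
# interpolation clause of D1 come for free; only the growth bound constrains `α`

Cell `pub/bsd-wall` (D-0145 line `route-BirchSwinnertonDyer-CyclotomicUntwist`), seat `bsd-line-cycu-p3`
(prover seat 3/3), helper toward crux K1 `PSRankOneLowerHalfAtThree` (stmt-BirchSwinnertonDyer-21580) and
its want F1 (`wi-84943`, `∃ 𝓛, IsPSCyclotomicLFunctionOf W η α 𝓛`).  Fourth file of the series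
(`…EigensymbolPushforward`, `…EigensymbolCharValues`, `…UntwistedLFunctionExistence`, this, and
`…CanonicalEigensymbolExistence` for the consequences).  THEOREMS ONLY (no definition, no named fact, no
`sorry`).  BSD is not proved by this file and no crux of the route is proved by it.

WHAT.  Files I–III construct the D1 object from an untwist eigensymbol `Φ` on `ℤ[1/p]` — (S1) `ℤ`-periodic,
(S2) `∑_j Φ((r+j)/p) = αΦ(r)`, (S3) `Φ(r) − (α/p)Φ(pr) = H(r) := ∑_{b mod p^c} η(b)[r + b/p^c]⁺_f`, (S4)
bounded.  This file shows that (S1)–(S3) have, for EVERY `α` with `α ≠ p`, EXACTLY ONE solution on `ℤ[1/p]`,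
given by a closed formula in the plus symbols of `f` (no newform `g`, no Atkin–Li, no `U_p`-eigenvalue
enters):

  `Ψ(a/pⁿ) = T(a/pⁿ, n)`,  `T(r, n) := ∑_{k<n} (α/p)ᵏ H(pᵏ r) + (α/p)ⁿ (1 − α/p)⁻¹ H(0)`   (canonical symbol),

the finite form of `Φ_g = ∑_k (α/p)ᵏ Φ_h(pᵏ ·)`, `h = g − αg(p·) = f ⊗ η̄`, that the deprivation identity
(S3) forces.  §1: `H` is `ℤ`-periodic (`twistSymbol_add_intCast`) and — the key point — KILLED BY `U_p` when
`η` is PRIMITIVE of conductor `p^c`, `c ≥ 1`: `∑_{j mod p} H((r+j)/p) = 0` (`sum_twistSymbol_div_eq_zero`: the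
shift `j p^{c−1}` reorganises the double sum into fibre sums of `η` over `ℤ/p^c → ℤ/p^{c−1}`, which vanish —
tree `sum_fiber_eq_zero_of_not_factorsThrough`; this is `a_{pn}(f ⊗ η̄) = 0` in symbols).  §2: `T(r, n)` does
not depend on `n` once `pⁿ r ∈ ℤ` (`canonical_robust`), so `Ψ` is well defined on `ℤ[1/p]`.  §3: for ANY
`ℤ`-periodic `H` killed by `U_p`, the system `Ψ(a/pⁿ) = T(a/pⁿ, n)` (hypothesis-equation `hΨ`) satisfies
(S1) `canonical_add_intCast`, (S3) `canonical_deprivation` (`α ≠ p`), and (S2) `sum_canonical_div_eq` (no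
condition on `α`).  §4: any two (S1)+(S3) symbols agree on `ℤ[1/p]` (`eq_of_deprivation`) — so the `g`-symbol
`τ(η){∞,·}⁺_g/Ω⁺_f` of print, when it exists, IS `Ψ`.

UPSHOT (drawn in file V): additivity and ALL interpolation clauses of D1 carry no information about `α`; an
order-`½` `𝓛` with `IsUntwistedPAdicLFunction p f η α 𝓛` exists as soon as `Ψ_{f,η,α}` is bounded on
`ℤ[1/p]` (and, the `g`-symbol being `Ψ`, that is exactly what Mazur–Tate–Teitelbaum §I.14 / Bellaïche
Thm. 6.7.9 + Manin–Drinfeld give for `α = a_p(g)`): the route's want F1 in the tree's existing vocabulary.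

References: [cite: MazurTateTeitelbaum1986Invent, §I.4 (4.2), §I.10 and §I.14] · [cite: Bellaiche2021, §6.7.2 and Thm. 6.7.9]
· [cite: AtkinLi1978, Thm. 3.1].
-/

noncomputable section

open Finset
open Literature.NumberTheory.EllipticCurves Literature.NumberTheory.EllipticCurves.ModularForms
  Literature.NumberTheory.IwasawaTheory

-- single-conjunct summit: `Summit.BirchSwinnertonDyer.BirchSwinnertonDyer.…` repeats the name by design
set_option linter.dupNamespace false

namespace Summit.BirchSwinnertonDyer.BirchSwinnertonDyer.Theorems.PSUntwistExistence

variable {p : ℕ} [Fact p.Prime] {c : ℕ} {η : DirichletCharacter ℂ_[p] (p ^ c)} {N : ℕ}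
  {f : CuspForm (CongruenceSubgroup.Gamma0 N) 2} {α : ℂ_[p]} {H Ψ Φ : ℚ → ℂ_[p]}

/-! ### §1 The `p`-deprived twisted symbol `H(r) = ∑_b η(b) [r + b/p^c]⁺_f`: periodic, killed by `U_p` -/

/-- `H(r + z) = H(r)` for `z ∈ ℤ`: each `[r + z + b/p^c]⁺ = [r + b/p^c]⁺` (tree `ratPlusSymbol_add_intCast_eq`,
translation invariance of modular symbols, MTT §I.4). [cite: MazurTateTeitelbaum1986Invent, §I.4 (4.2)] -/
theorem twistSymbol_add_intCast [NeZero N]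
    (hH : ∀ r : ℚ, H r =
      ∑ b : ZMod (p ^ c), η b * algebraMap ℚ ℂ_[p] (ratPlusSymbol f (r + (b.val : ℚ) / (p : ℚ) ^ c)))
    (r : ℚ) (z : ℤ) : H (r + z) = H r := by
  rw [hH, hH]
  refine Finset.sum_congr rfl fun b _ ↦ ?_
  rw [add_right_comm, ratPlusSymbol_add_intCast_eq]

omit [Fact p.Prime] in
/-- In `ℤ/p^{c'+1}`: `p^{c'} · ((j₁ + j) mod p) = p^{c'} j₁ + p^{c'} j` (the wrap-around is a multiple of
`p^{c'+1} = 0`). [folklore] -/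
theorem natCast_pow_mul_fin_add (c' : ℕ) (j₁ j : Fin p) :
    (p : ZMod (p ^ (c' + 1))) ^ c' * (((j₁ + j : Fin p) : ℕ) : ZMod (p ^ (c' + 1))) =
      (p : ZMod (p ^ (c' + 1))) ^ c' * ((j₁ : ℕ) : ZMod (p ^ (c' + 1))) +
        (p : ZMod (p ^ (c' + 1))) ^ c' * ((j : ℕ) : ZMod (p ^ (c' + 1))) := by
  have hdiv : p ^ c' * (((j₁ : ℕ) + (j : ℕ)) % p) + p ^ (c' + 1) * (((j₁ : ℕ) + (j : ℕ)) / p) =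
      p ^ c' * (j₁ : ℕ) + p ^ c' * (j : ℕ) := by
    rw [← mul_add, pow_succ, mul_assoc, ← mul_add, Nat.mod_add_div]
  have hP : (p : ZMod (p ^ (c' + 1))) ^ (c' + 1) = 0 := by exact_mod_cast ZMod.natCast_self (p ^ (c' + 1))
  have h := congr_arg (Nat.cast : ℕ → ZMod (p ^ (c' + 1))) hdiv
  push_cast at h
  rw [Fin.val_add]
  linear_combination h - ((((j₁ : ℕ) + (j : ℕ)) / p : ℕ) : ZMod (p ^ (c' + 1))) * hP

/-- **`U_p` kills the `p`-deprived twist**: for `η` PRIMITIVE mod `p^{c'+1}`,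
`∑_{j mod p} H((r + j)/p) = 0`.  Indeed `(r+j)/p + b/p^{c'+1} ≡ r/p + (b + j p^{c'})/p^{c'+1}` (mod `ℤ`), so
`∑_j [(r+j)/p + b/p^{c'+1}]⁺` is the sum of `y ↦ [r/p + y/p^{c'+1}]⁺` over the fibre of `b mod p^{c'}` — it
only depends on `b mod p^{c'}` — and then `∑_b η(b) (…)` factors through the coset sums of `η` over the
fibres of `ℤ/p^{c'+1} → ℤ/p^{c'}`, which vanish for a primitive character (tree
`sum_fiber_eq_zero_of_not_factorsThrough`).  This is the symbol form of `U_p (g − α g(p·)) = 0`, i.e. of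
`a_{pn}(f ⊗ η̄) = 0` (Bellaïche §6.7.2; MTT §I.14). [cite: Bellaiche2021, §6.7.2] [cite: MazurTateTeitelbaum1986Invent, §I.14] -/
theorem sum_twistSymbol_div_eq_zero [NeZero N] {c' : ℕ} {η : DirichletCharacter ℂ_[p] (p ^ (c' + 1))}
    (hη : η.IsPrimitive) {H : ℚ → ℂ_[p]}
    (hH : ∀ r : ℚ, H r = ∑ b : ZMod (p ^ (c' + 1)), η b *
      algebraMap ℚ ℂ_[p] (ratPlusSymbol f (r + (b.val : ℚ) / (p : ℚ) ^ (c' + 1))))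
    (r : ℚ) : ∑ j : Fin p, H ((r + j) / p) = 0 := by
  classical
  have hp : p.Prime := Fact.out
  haveI : NeZero p := ⟨hp.ne_zero⟩
  haveI : NeZero (p ^ (c' + 1)) := ⟨pow_ne_zero _ hp.ne_zero⟩
  haveI : NeZero (p ^ c') := ⟨pow_ne_zero _ hp.ne_zero⟩
  have hp0 : (p : ℚ) ≠ 0 := by exact_mod_cast hp.ne_zero
  have hP0 : (p : ℚ) ^ (c' + 1) ≠ 0 := pow_ne_zero _ hp0
  -- notation: `t j = p^{c'} j mod p^{c'+1}`, `G y = [r/p + y/p^{c'+1}]⁺`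
  set t : Fin p → ZMod (p ^ (c' + 1)) := fun j ↦ ((p ^ c' * (j : ℕ) : ℕ) : ZMod (p ^ (c' + 1))) with ht
  set G : ZMod (p ^ (c' + 1)) → ℂ_[p] := fun y ↦
    algebraMap ℚ ℂ_[p] (ratPlusSymbol f (r / p + (y.val : ℚ) / (p : ℚ) ^ (c' + 1))) with hG
  -- `[(r+j)/p + b/p^{c'+1}]⁺ = G (b + t j)`
  have hshift : ∀ (j : Fin p) (b : ZMod (p ^ (c' + 1))),
      algebraMap ℚ ℂ_[p] (ratPlusSymbol f ((r + j) / p + (b.val : ℚ) / (p : ℚ) ^ (c' + 1))) =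
        G (b + t j) := by
    intro j b
    have hvt : (t j).val = p ^ c' * (j : ℕ) := by
      simp only [ht]
      refine ZMod.val_natCast_of_lt ?_
      calc p ^ c' * (j : ℕ) < p ^ c' * p := Nat.mul_lt_mul_of_pos_left j.is_lt (pow_pos hp.pos _)
        _ = p ^ (c' + 1) := (pow_succ _ _).symm
    have hsum : ((b + t j).val : ℚ) + (p : ℚ) ^ (c' + 1) * (((b.val + p ^ c' * (j : ℕ)) / p ^ (c' + 1) : ℕ) : ℚ) =
        (b.val : ℚ) + (p : ℚ) ^ c' * (j : ℚ) := by
      have h : (b + t j).val + p ^ (c' + 1) * ((b.val + p ^ c' * (j : ℕ)) / p ^ (c' + 1)) =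
          b.val + p ^ c' * (j : ℕ) := by
        rw [ZMod.val_add, hvt]
        exact Nat.mod_add_div _ _
      exact_mod_cast h
    have hd : (((b.val + p ^ c' * (j : ℕ)) / p ^ (c' + 1) : ℕ) : ℚ) =
        ((b.val : ℚ) + (p : ℚ) ^ c' * (j : ℚ) - ((b + t j).val : ℚ)) / (p : ℚ) ^ (c' + 1) := by
      rw [eq_div_iff hP0]
      linear_combination hsum
    have key : (r + j) / p + (b.val : ℚ) / (p : ℚ) ^ (c' + 1) =
        r / p + ((b + t j).val : ℚ) / (p : ℚ) ^ (c' + 1) +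
          ((((b.val + p ^ c' * (j : ℕ)) / p ^ (c' + 1) : ℕ) : ℤ) : ℚ) := by
      rw [Int.cast_natCast, hd]
      field_simp
      ring
    simp only [hG]
    rw [key, ratPlusSymbol_add_intCast_eq]
  -- the inner `j`-sum is the fibre sum of `G` over `b mod p^{c'}`
  have hfib : ∀ b : ZMod (p ^ (c' + 1)), ∑ j : Fin p, G (b + t j) =
      ∑ y ∈ univ.filter (fun y : ZMod (p ^ (c' + 1)) ↦
        ZMod.castHom (pow_dvd_pow p c'.le_succ) (ZMod (p ^ c')) y =
          ZMod.castHom (pow_dvd_pow p c'.le_succ) (ZMod (p ^ c')) b), G y := by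
    intro b
    set b₀ := ZMod.castHom (pow_dvd_pow p c'.le_succ) (ZMod (p ^ c')) b with hb₀
    have hmem : b ∈ univ.filter (fun y : ZMod (p ^ (c' + 1)) ↦
        ZMod.castHom (pow_dvd_pow p c'.le_succ) (ZMod (p ^ c')) y = b₀) := by simp [hb₀]
    rw [filter_castHom_eq_image, Finset.mem_image] at hmem
    obtain ⟨j₁, -, hj₁⟩ := hmem
    rw [filter_castHom_eq_image, Finset.sum_image fun j _ j' _ h ↦ by
      have hv := congr_arg ZMod.val h
      simp only [val_classLift] at hv
      exact Fin.ext (Nat.eq_of_mul_eq_mul_left (pow_pos hp.pos c') (by omega))]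
    -- reindex `j ↦ j₁ + j`
    refine Fintype.sum_equiv (Equiv.addLeft j₁) _ _ fun j ↦ ?_
    rw [Equiv.coe_addLeft, ← hj₁]
    simp only [ht]
    push_cast
    rw [natCast_pow_mul_fin_add]
    ring
  -- assemble: `∑_j H((r+j)/p) = ∑_b η(b) F(b mod p^{c'}) = ∑_{b₀} F(b₀) ∑_{b ≡ b₀} η(b) = 0`
  calc ∑ j : Fin p, H ((r + j) / p)
      = ∑ j : Fin p, ∑ b : ZMod (p ^ (c' + 1)), η b * G (b + t j) := by
        refine Finset.sum_congr rfl fun j _ ↦ ?_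
        rw [hH]
        exact Finset.sum_congr rfl fun b _ ↦ by rw [hshift]
    _ = ∑ b : ZMod (p ^ (c' + 1)), η b * ∑ j : Fin p, G (b + t j) := by
        rw [Finset.sum_comm]
        exact Finset.sum_congr rfl fun b _ ↦ by rw [Finset.mul_sum]
    _ = ∑ b₀ : ZMod (p ^ c'), ∑ b ∈ univ.filter (fun b : ZMod (p ^ (c' + 1)) ↦
          ZMod.castHom (pow_dvd_pow p c'.le_succ) (ZMod (p ^ c')) b = b₀),
          η b * ∑ y ∈ univ.filter (fun y : ZMod (p ^ (c' + 1)) ↦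
            ZMod.castHom (pow_dvd_pow p c'.le_succ) (ZMod (p ^ c')) y = b₀), G y := by
        rw [← Finset.sum_fiberwise Finset.univ (ZMod.castHom (pow_dvd_pow p c'.le_succ) (ZMod (p ^ c')))]
        refine Finset.sum_congr rfl fun b₀ _ ↦ Finset.sum_congr rfl fun b hb ↦ ?_
        rw [hfib b, (Finset.mem_filter.mp hb).2]
    _ = 0 := by
        refine Finset.sum_eq_zero fun b₀ _ ↦ ?_
        rw [← Finset.sum_mul, sum_fiber_eq_zero_of_not_factorsThrough η (pow_dvd_pow p c'.le_succ)
          (not_factorsThrough_of_isPrimitive hη (Nat.pow_lt_pow_right hp.one_lt c'.lt_succ_self)) b₀,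
          zero_mul]

/-! ### §2 The canonical values `T(r, n) = ∑_{k<n} qᵏ H(pᵏ r) + qⁿ (1 − q)⁻¹ H(0)`, `q = α/p` -/

/-- **Robustness of the canonical formula**: if `p^n r ∈ ℤ` (so `H(p^m r) = H(0)` for `m ≥ n`) then
`T(r, m) = T(r, n)` for every `m ≥ n`, where `T(r, n) = ∑_{k<n} qᵏ H(pᵏ r) + qⁿ(1 − q)⁻¹H(0)`:
`T(r, n+1) − T(r, n) = qⁿ (H(pⁿ r) − H(0)) = 0`.  So `Ψ(a/pⁿ) := T(a/pⁿ, n)` does not depend on the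
representation `a/pⁿ` of a point of `ℤ[1/p]`. [cite: MazurTateTeitelbaum1986Invent, §I.14] -/
theorem canonical_robust (hH1 : ∀ (r : ℚ) (z : ℤ), H (r + z) = H r) (hq : α / p ≠ 1) {r : ℚ} {n : ℕ}
    (hn : ∃ z : ℤ, (p : ℚ) ^ n * r = z) {m : ℕ} (hm : n ≤ m) :
    ∑ k ∈ range m, (α / p) ^ k * H ((p : ℚ) ^ k * r) + (α / p) ^ m * (1 - α / p)⁻¹ * H 0 =
      ∑ k ∈ range n, (α / p) ^ k * H ((p : ℚ) ^ k * r) + (α / p) ^ n * (1 - α / p)⁻¹ * H 0 := by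
  have h1 : (1 - α / p) ≠ 0 := sub_ne_zero.mpr (Ne.symm hq)
  induction m, hm using Nat.le_induction with
  | base => rfl
  | succ m hm ih =>
    rw [← ih, Finset.sum_range_succ]
    -- `H(p^m r) = H(0)` since `p^m r = p^{m-n} (p^n r) ∈ ℤ`
    obtain ⟨z, hz⟩ := hn
    have hint : H ((p : ℚ) ^ m * r) = H 0 := by
      have : (p : ℚ) ^ m * r = (0 : ℚ) + ((p ^ (m - n) * z : ℤ) : ℚ) := by
        rw [zero_add, Int.cast_mul, Int.cast_pow, Int.cast_natCast, ← hz, ← mul_assoc, ← pow_add,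
          Nat.sub_add_cancel hm]
      rw [this, hH1]
    rw [hint]
    have : (α / p) ^ (m + 1) * (1 - α / p)⁻¹ * H 0 =
        (α / p) ^ m * (1 - α / p)⁻¹ * H 0 - (α / p) ^ m * H 0 := by
      rw [pow_succ]
      field_simp
      ring
    rw [this]
    ring

/-- A point `a/pⁿ` of `ℤ[1/p]` (`a : ℤ`) satisfies `pⁿ · (a/pⁿ) = a ∈ ℤ`. [folklore] -/
theorem pow_mul_div_pow_eq (n : ℕ) (a : ℤ) : (p : ℚ) ^ n * ((a : ℚ) / (p : ℚ) ^ n) = a := by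
  have hp0 : (p : ℚ) ^ n ≠ 0 := pow_ne_zero _ (Nat.cast_ne_zero.mpr (Fact.out : p.Prime).ne_zero)
  field_simp

/-! ### §3 The canonical symbol `Ψ(a/pⁿ) = T(a/pⁿ, n)` satisfies (S1), (S3) and — since `U_p H = 0` — (S2) -/

/-- Points of `ℤ[1/p]`: `a/pⁿ + z = (a + z pⁿ)/pⁿ`. [folklore] -/
theorem div_pow_add_intCast (n : ℕ) (a z : ℤ) :
    (a : ℚ) / (p : ℚ) ^ n + z = ((a + z * p ^ n : ℤ) : ℚ) / (p : ℚ) ^ n := by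
  have hp0 : (p : ℚ) ^ n ≠ 0 := pow_ne_zero _ (Nat.cast_ne_zero.mpr (Fact.out : p.Prime).ne_zero)
  push_cast
  field_simp

/-- Points of `ℤ[1/p]`: `(a/pⁿ + j)/p = (a + j pⁿ)/p^{n+1}`. [folklore] -/
theorem div_pow_add_natCast_div (n : ℕ) (a : ℤ) (j : ℕ) :
    ((a : ℚ) / (p : ℚ) ^ n + j) / p = ((a + j * p ^ n : ℤ) : ℚ) / (p : ℚ) ^ (n + 1) := by
  have hp0 : (p : ℚ) ≠ 0 := Nat.cast_ne_zero.mpr (Fact.out : p.Prime).ne_zero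
  push_cast
  field_simp
  ring

/-- **(S1) for the canonical symbol**: `Ψ(a/pⁿ + z) = Ψ(a/pⁿ)` — each `H(pᵏ(r + z)) = H(pᵏ r)` by the
`ℤ`-periodicity of `H`. [cite: MazurTateTeitelbaum1986Invent, §I.4 (4.2)] -/
theorem canonical_add_intCast (hH1 : ∀ (r : ℚ) (z : ℤ), H (r + z) = H r)
    (hΨ : ∀ (n : ℕ) (a : ℤ), Ψ ((a : ℚ) / (p : ℚ) ^ n) =
      ∑ k ∈ range n, (α / p) ^ k * H ((p : ℚ) ^ k * ((a : ℚ) / (p : ℚ) ^ n)) +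
        (α / p) ^ n * (1 - α / p)⁻¹ * H 0)
    (n : ℕ) (a z : ℤ) : Ψ ((a : ℚ) / (p : ℚ) ^ n + z) = Ψ ((a : ℚ) / (p : ℚ) ^ n) := by
  rw [div_pow_add_intCast, hΨ, hΨ]
  congr 1
  refine Finset.sum_congr rfl fun k _ ↦ ?_
  rw [← div_pow_add_intCast, mul_add, show (p : ℚ) ^ k * (z : ℚ) = ((p ^ k * z : ℤ) : ℚ) by push_cast; ring,
    hH1]

/-- **(S3) for the canonical symbol**: `Ψ(a/pⁿ) − (α/p) Ψ(p · a/pⁿ) = H(a/pⁿ)` — for `n = m + 1` peel off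
the term `k = 0` of `T(a/p^{m+1}, m+1)` and shift the rest onto `T(a/p^m, m)`; for `n = 0` both values are
`(1 − α/p)⁻¹ H(0)` and `H(a) = H(0)` (here `α ≠ p` is used). This is the deprivation identity
`Φ_g − (α/p)Φ_g(p·) = Φ_{f⊗η̄}` solved on `ℤ[1/p]`. [cite: MazurTateTeitelbaum1986Invent, §I.14] [cite: Bellaiche2021, §6.7.2] -/
theorem canonical_deprivation (hH1 : ∀ (r : ℚ) (z : ℤ), H (r + z) = H r) (hq : α / p ≠ 1)
    (hΨ : ∀ (n : ℕ) (a : ℤ), Ψ ((a : ℚ) / (p : ℚ) ^ n) =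
      ∑ k ∈ range n, (α / p) ^ k * H ((p : ℚ) ^ k * ((a : ℚ) / (p : ℚ) ^ n)) +
        (α / p) ^ n * (1 - α / p)⁻¹ * H 0)
    (n : ℕ) (a : ℤ) :
    Ψ ((a : ℚ) / (p : ℚ) ^ n) - α / p * Ψ (p * ((a : ℚ) / (p : ℚ) ^ n)) = H ((a : ℚ) / (p : ℚ) ^ n) := by
  have hp0 : (p : ℚ) ≠ 0 := Nat.cast_ne_zero.mpr (Fact.out : p.Prime).ne_zero
  have h1 : (1 - α / p) ≠ 0 := sub_ne_zero.mpr (Ne.symm hq)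
  rcases n with _ | m
  · -- `a/p⁰ = a`, `p · a = (pa)/p⁰`, and `H(a) = H(0)`
    have hpa : (p : ℚ) * ((a : ℚ) / (p : ℚ) ^ 0) = ((p * a : ℤ) : ℚ) / (p : ℚ) ^ 0 := by push_cast; ring
    have hHa : H ((a : ℚ) / (p : ℚ) ^ 0) = H 0 := by
      rw [show (a : ℚ) / (p : ℚ) ^ 0 = (0 : ℚ) + (a : ℤ) by simp, hH1]
    rw [hpa, hΨ, hΨ, hHa]
    simp only [Finset.range_zero, Finset.sum_empty, zero_add, pow_zero, one_mul]
    field_simp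
  · have hpa : (p : ℚ) * ((a : ℚ) / (p : ℚ) ^ (m + 1)) = (a : ℚ) / (p : ℚ) ^ m := by
      field_simp; ring
    rw [hpa, hΨ, hΨ, Finset.sum_range_succ']
    have hk : ∀ k ∈ range m, (α / p) ^ (k + 1) * H ((p : ℚ) ^ (k + 1) * ((a : ℚ) / (p : ℚ) ^ (m + 1))) =
        α / p * ((α / p) ^ k * H ((p : ℚ) ^ k * ((a : ℚ) / (p : ℚ) ^ m))) := by
      intro k _
      rw [show (p : ℚ) ^ (k + 1) * ((a : ℚ) / (p : ℚ) ^ (m + 1)) = (p : ℚ) ^ k * ((a : ℚ) / (p : ℚ) ^ m) by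
        field_simp; ring]
      ring
    rw [Finset.sum_congr rfl hk, ← Finset.mul_sum, pow_zero, pow_zero, one_mul, one_mul]
    ring

/-- **(S2) for the canonical symbol**: `∑_{j mod p} Ψ((a/pⁿ + j)/p) = α Ψ(a/pⁿ)`.  With `r = a/pⁿ` and
`r_j = (r + j)/p = (a + j pⁿ)/p^{n+1}`: `T(r_j, n+1) = H(r_j) + (α/p) ∑_{k<n} (α/p)ᵏ H(pᵏ r + pᵏ j) + …`, the
`j`-dependence of all terms but the first disappears by periodicity, `∑_j H(r_j) = 0` because `U_p` kills the
`p`-deprived twist (hypothesis `hH2`, = `sum_twistSymbol_div_eq_zero`), and `p · (α/p) = α`.  No condition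
on `α` is used. [cite: MazurTateTeitelbaum1986Invent, §I.4 (4.2) and §I.14] [cite: Bellaiche2021, §6.7.2] -/
theorem sum_canonical_div_eq (hH1 : ∀ (r : ℚ) (z : ℤ), H (r + z) = H r)
    (hH2 : ∀ r : ℚ, ∑ j : Fin p, H ((r + j) / p) = 0)
    (hΨ : ∀ (n : ℕ) (a : ℤ), Ψ ((a : ℚ) / (p : ℚ) ^ n) =
      ∑ k ∈ range n, (α / p) ^ k * H ((p : ℚ) ^ k * ((a : ℚ) / (p : ℚ) ^ n)) +
        (α / p) ^ n * (1 - α / p)⁻¹ * H 0)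
    (n : ℕ) (a : ℤ) :
    ∑ j : Fin p, Ψ (((a : ℚ) / (p : ℚ) ^ n + j) / p) = α * Ψ ((a : ℚ) / (p : ℚ) ^ n) := by
  have hp0 : (p : ℚ) ≠ 0 := Nat.cast_ne_zero.mpr (Fact.out : p.Prime).ne_zero
  have hp0' : (p : ℂ_[p]) ≠ 0 := Nat.cast_ne_zero.mpr (Fact.out : p.Prime).ne_zero
  -- each `Ψ(r_j)` is `H(r_j) + (α/p) · (the j-independent tail of T(r, n))`
  have hj : ∀ j : Fin p, Ψ (((a : ℚ) / (p : ℚ) ^ n + j) / p) =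
      H (((a : ℚ) / (p : ℚ) ^ n + j) / p) +
        α / p * (∑ k ∈ range n, (α / p) ^ k * H ((p : ℚ) ^ k * ((a : ℚ) / (p : ℚ) ^ n)) +
          (α / p) ^ n * (1 - α / p)⁻¹ * H 0) := by
    intro j
    rw [show ((j : ℕ) : ℚ) = ((j : ℕ) : ℕ) from rfl, div_pow_add_natCast_div, hΨ, Finset.sum_range_succ',
      ← div_pow_add_natCast_div]
    have hk : ∀ k ∈ range n,
        (α / p) ^ (k + 1) * H ((p : ℚ) ^ (k + 1) * (((a : ℚ) / (p : ℚ) ^ n + ((j : ℕ) : ℚ)) / p)) =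
          α / p * ((α / p) ^ k * H ((p : ℚ) ^ k * ((a : ℚ) / (p : ℚ) ^ n))) := by
      intro k _
      rw [show (p : ℚ) ^ (k + 1) * (((a : ℚ) / (p : ℚ) ^ n + ((j : ℕ) : ℚ)) / p) =
          (p : ℚ) ^ k * ((a : ℚ) / (p : ℚ) ^ n) + ((p ^ k * (j : ℕ) : ℤ) : ℚ) by push_cast; field_simp; ring,
        hH1]
      ring
    rw [Finset.sum_congr rfl hk, ← Finset.mul_sum, pow_zero, one_mul, pow_zero, one_mul]
    ring
  rw [Finset.sum_congr rfl fun j _ ↦ hj j, Finset.sum_add_distrib, hH2, zero_add, Finset.sum_const,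
    Finset.card_univ, Fintype.card_fin, ← hΨ, nsmul_eq_mul]
  field_simp

/-! ### §4 Uniqueness: (S1) and (S3) determine a symbol on `ℤ[1/p]` (for `α ≠ p`) -/

/-- **Two symbols with (S1) and (S3) for the same `(H, α)`, `α ≠ p`, agree on `ℤ[1/p]`.**  Their
difference `D` satisfies `D(r) = (α/p) D(pr)` and is `ℤ`-periodic: `D(a) = D(0) = (α/p)D(0)` forces
`D(0) = 0`, and `D(a/p^{m+1}) = (α/p) D(a/p^m) = 0` by induction.  (So the `g`-symbol, when it exists, IS
the canonical symbol.) [cite: MazurTateTeitelbaum1986Invent, §I.14] -/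
theorem eq_of_deprivation (hq : α / p ≠ 1)
    (hΦ1 : ∀ (n : ℕ) (a z : ℤ), Φ ((a : ℚ) / (p : ℚ) ^ n + z) = Φ ((a : ℚ) / (p : ℚ) ^ n))
    (hΦ3 : ∀ (n : ℕ) (a : ℤ),
      Φ ((a : ℚ) / (p : ℚ) ^ n) - α / p * Φ (p * ((a : ℚ) / (p : ℚ) ^ n)) = H ((a : ℚ) / (p : ℚ) ^ n))
    (hΨ1 : ∀ (n : ℕ) (a z : ℤ), Ψ ((a : ℚ) / (p : ℚ) ^ n + z) = Ψ ((a : ℚ) / (p : ℚ) ^ n))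
    (hΨ3 : ∀ (n : ℕ) (a : ℤ),
      Ψ ((a : ℚ) / (p : ℚ) ^ n) - α / p * Ψ (p * ((a : ℚ) / (p : ℚ) ^ n)) = H ((a : ℚ) / (p : ℚ) ^ n))
    (n : ℕ) (a : ℤ) : Φ ((a : ℚ) / (p : ℚ) ^ n) = Ψ ((a : ℚ) / (p : ℚ) ^ n) := by
  have hp0 : (p : ℚ) ≠ 0 := Nat.cast_ne_zero.mpr (Fact.out : p.Prime).ne_zero
  -- the difference satisfies the homogeneous relation
  have hD : ∀ (n : ℕ) (a : ℤ), Φ ((a : ℚ) / (p : ℚ) ^ n) - Ψ ((a : ℚ) / (p : ℚ) ^ n) =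
      α / p * (Φ (p * ((a : ℚ) / (p : ℚ) ^ n)) - Ψ (p * ((a : ℚ) / (p : ℚ) ^ n))) := by
    intro n a
    linear_combination hΦ3 n a - hΨ3 n a
  rw [← sub_eq_zero]
  induction n generalizing a with
  | zero =>
    -- `D(a) = D(0)` and `D(0) = (α/p) D(0)`
    have h0 : ∀ b : ℤ, Φ ((b : ℚ) / (p : ℚ) ^ 0) - Ψ ((b : ℚ) / (p : ℚ) ^ 0) =
        Φ (((0 : ℤ) : ℚ) / (p : ℚ) ^ 0) - Ψ (((0 : ℤ) : ℚ) / (p : ℚ) ^ 0) := by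
      intro b
      rw [show (b : ℚ) / (p : ℚ) ^ 0 = ((0 : ℤ) : ℚ) / (p : ℚ) ^ 0 + (b : ℤ) by simp, hΦ1, hΨ1]
    have hrec := hD 0 0
    rw [show (p : ℚ) * (((0 : ℤ) : ℚ) / (p : ℚ) ^ 0) = ((0 : ℤ) : ℚ) / (p : ℚ) ^ 0 by simp] at hrec
    have hzero : Φ (((0 : ℤ) : ℚ) / (p : ℚ) ^ 0) - Ψ (((0 : ℤ) : ℚ) / (p : ℚ) ^ 0) = 0 := by
      have h1 : (1 - α / p) ≠ 0 := sub_ne_zero.mpr (Ne.symm hq)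
      have : (1 - α / p) * (Φ (((0 : ℤ) : ℚ) / (p : ℚ) ^ 0) - Ψ (((0 : ℤ) : ℚ) / (p : ℚ) ^ 0)) = 0 := by
        linear_combination hrec
      exact (mul_eq_zero.mp this).resolve_left h1
    rw [h0 a, hzero]
  | succ m ih =>
    rw [hD, show (p : ℚ) * ((a : ℚ) / (p : ℚ) ^ (m + 1)) = (a : ℚ) / (p : ℚ) ^ m by field_simp; ring, ih a,
      mul_zero]

end Summit.BirchSwinnertonDyer.BirchSwinnertonDyer.Theorems.PSUntwistExistence

end
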